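import Literature.AlgebraicGeometry.HodgeTheory.RationalTransportIntegralLattice      -- ★ p725501 (S1-frame): transport detects integrality
import Literature.AlgebraicGeometry.HodgeTheory.FlatSectionNonvanishing              -- ★ `transportFun_injective`
import Mathlib.AlgebraicTopology.FundamentalGroupoid.SimplyConnected
import HarnessLib

/-!
# A flat integral frame of `Rᵏ f_* ℚ` over a path-connected base with trivial monodromy, extending a given integral basis at a
# point (U-e P4b leaf (N1-exist): existence of `IsFlatIntegralFrame`)

Topic `AlgebraicGeometry/HodgeTheory`; namespace `Literature.AlgebraicGeometry.HodgeTheory`.  THEOREMS ONLY (no definition, no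
named fact, no instance, no `sorry`).  Cell hodgecm-mathlib (D-0151), (U)-HEAD node U-e, socket P4, B-p05 (g13)'s glue plan
`Ue_P4b_of` v0.3 step 3 (N1) «flat integral frame»; the notion is B-typ02 (g11)'s (N1) `HodgeTheory.IsFlatIntegralFrame f hU γ`
(`typers/B-typ02/Ue-P4b-FlatFrame.v0.2.typ02g11.lean` :123; HOME-only), whose three clauses are reproduced here VERBATIM as the
conclusion.  Hand B-p03 (g13).  HC_CM is proved only modulo the 7 printed citations until rung 0 closes; books 0.

[VoisinHodgeI2002, §9.2.1]: over a contractible (simply connected) open `W`, a local system is trivial — parallel transport from a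
base point `x₀` does not depend on the path, so a basis of the stalk at `x₀` propagates to a FLAT frame `γ x`; Rem. 10.17: the
integral structure is flat, so an INTEGRAL basis propagates to integral bases (★ `IsHomotopicallyLocallyTrivialOn.isIntegralClass_transportFun_iff`,
p725501).  Engines: ★ `exists_ratTransport` (rational transports exist), ★ `transportFun_trans`/`_refl` + Mathlib's groupoid laws of
`Path.Homotopic.Quotient` (path independence from trivial monodromy at `x₀`), ★ `transportLinear` (transport is `ℂ`-linear and
injective: linear independence and `ℤ`-spans are carried along).

* `transportFun_eq_of_trivial_monodromy` — trivial monodromy at `x₀` ⇒ transport `x₀ ⤳ x` is independent of the path class;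
* `linearIndependent_transportFun`, `mem_span_int_range_transportFun_iff` — transport (injective, ★ `transportFun_injective`) carries linearly
  independent families to linearly independent families and `ℤ`-spans onto `ℤ`-spans; with ★ p725501, «`ℤ`-span = integral
  classes» is carried along;
* `exists_flatIntegralFrame_eq` — **(N1-exist)**: over `W` path connected with trivial monodromy of `Rᵏ f_* ℂ` at `x₀ ∈ W` and
  `f` homotopically locally trivial over `W`, every family `γ₀ : ι → Hᵏ(X_{x₀}; ℚ)` whose complexification is `ℂ`-linearly
  independent with `ℤ`-span = the integral classes extends to `γ : ∀ x : W, ι → Hᵏ(X_x; ℚ)` with `γ x₀ = γ₀` satisfying the three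
  clauses of `IsFlatIntegralFrame` (any degree `k`; the notion is `k = 1`);
* `exists_flatIntegralFrame_eq_of_simplyConnectedSpace` — the same over a simply connected `W` (e.g. a chart ball: contractible).

## References
* [VoisinHodgeI2002] C. Voisin, *Hodge Theory and Complex Algebraic Geometry I*, CUP 2002, §9.2.1 (local systems, transport,
  triviality over contractible opens), Rem. 10.17 (the integral structure is flat).
* [LangeBirkenhake1992] H. Lange, Ch. Birkenhake, *Complex Abelian Varieties* (1992), Ch. 8 §8.1 (families of marked abelian
  varieties: the symplectic basis is locally constant).
-/

set_option autoImplicit false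

noncomputable section

open CategoryTheory AlgebraicGeometry
open _root_.Topology
open Literature.AlgebraicTopology.SingularHomology
open Literature.AlgebraicGeometry.Motives (SchemeOver ComplexPoints fiberOver bettiCohomology)

namespace Literature.AlgebraicGeometry.HodgeTheory

section FlatFrame

variable {𝒳 S : SchemeOver ℂ} (f : 𝒳 ⟶ S) (k : ℕ) {W : Set (ComplexPoints S)} (hU : IsCohomologicallyLocallyTrivialOn f W)

/-! ### §1 Path independence from trivial monodromy at the base point -/

/-- **Trivial monodromy at `x₀` ⇒ transport from `x₀` is path independent**: if every loop class at `x₀` transports `Hᵏ(X_{x₀}; ℂ)`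
identically, then two path classes `x₀ ⤳ x` have the same transport (`p₁ = (p₁ p₂⁻¹) p₂` in the fundamental groupoid,
★ `transportFun_trans`). [cite: VoisinHodgeI2002, §9.2.1] -/
theorem transportFun_eq_of_trivial_monodromy {x₀ : W}
    (htriv : ∀ (p : Path.Homotopic.Quotient x₀ x₀) (c : complexBetti (fiberOver f x₀.1) k), transportFun f k hU p c = c)
    {x : W} (p₁ p₂ : Path.Homotopic.Quotient x₀ x) (c : complexBetti (fiberOver f x₀.1) k) :
    transportFun f k hU p₁ c = transportFun f k hU p₂ c := by
  have h := htriv (p₁.trans p₂.symm) c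
  calc transportFun f k hU p₁ c
      = transportFun f k hU ((p₁.trans p₂.symm).trans p₂) c := by
          rw [Path.Homotopic.Quotient.trans_assoc, Path.Homotopic.Quotient.symm_trans, Path.Homotopic.Quotient.trans_refl]
    _ = transportFun f k hU p₂ (transportFun f k hU (p₁.trans p₂.symm) c) := transportFun_trans f k hU _ _ c
    _ = transportFun f k hU p₂ c := by rw [h]

/-- In a simply connected `W` the monodromy of `Rᵏ f_* ℂ|_W` is trivial at every point (all loop classes are the constant class).
[cite: VoisinHodgeI2002, §9.2.1] -/
theorem transportFun_loop_eq_self_of_simplyConnectedSpace [SimplyConnectedSpace W] (x₀ : W)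
    (p : Path.Homotopic.Quotient x₀ x₀) (c : complexBetti (fiberOver f x₀.1) k) : transportFun f k hU p c = c := by
  rw [Subsingleton.elim p (Path.Homotopic.Quotient.refl x₀), transportFun_refl]

/-! ### §2 Transport carries linear independence and `ℤ`-spans -/

/-- **Transport carries `ℂ`-linearly independent families to `ℂ`-linearly independent families** (it is `ℂ`-linear, ★ `transportLinear`,
and injective). [cite: VoisinHodgeI2002, §9.2.1] -/
theorem linearIndependent_transportFun {s t : W} (p : Path.Homotopic.Quotient s t) {ι : Type}
    {c : ι → complexBetti (fiberOver f s.1) k} (hc : LinearIndependent ℂ c) :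
    LinearIndependent ℂ fun a ↦ transportFun f k hU p (c a) := by
  have h := hc.map' (transportLinear f k hU p) (LinearMap.ker_eq_bot.2 (transportFun_injective f k hU p))
  simpa only [Function.comp_def, transportLinear_apply] using h

/-- **Transport carries `ℤ`-spans onto `ℤ`-spans**: `β ∈ span_ℤ {p_* (c a)}` iff `β = p_* α` with `α ∈ span_ℤ {c a}` (transport is
additive, hence `ℤ`-linear, and injective with inverse `p⁻¹_*`). [cite: VoisinHodgeI2002, §9.2.1] -/
theorem mem_span_int_range_transportFun_iff {s t : W} (p : Path.Homotopic.Quotient s t) {ι : Type}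
    (c : ι → complexBetti (fiberOver f s.1) k) (β : complexBetti (fiberOver f t.1) k) :
    β ∈ Submodule.span ℤ (Set.range fun a ↦ transportFun f k hU p (c a)) ↔
      transportFun f k hU p.symm β ∈ Submodule.span ℤ (Set.range c) := by
  -- the `ℤ`-linear maps underlying transport along `p` and `p⁻¹`
  let T : complexBetti (fiberOver f s.1) k →ₗ[ℤ] complexBetti (fiberOver f t.1) k :=
    (transportLinear f k hU p).toAddMonoidHom.toIntLinearMap
  let T' : complexBetti (fiberOver f t.1) k →ₗ[ℤ] complexBetti (fiberOver f s.1) k :=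
    (transportLinear f k hU p.symm).toAddMonoidHom.toIntLinearMap
  have hT : ∀ a, T a = transportFun f k hU p a := fun _ ↦ rfl
  have hT' : ∀ b, T' b = transportFun f k hU p.symm b := fun _ ↦ rfl
  have hrange : (Set.range fun a ↦ transportFun f k hU p (c a)) = T '' Set.range c := by
    ext y
    simp only [Set.mem_range, Set.mem_image, exists_exists_eq_and, hT]
  constructor
  · intro hβ
    rw [hrange, ← Submodule.map_span] at hβ
    obtain ⟨α, hα, rfl⟩ := Submodule.mem_map.1 hβ
    rwa [hT, transportFun_symm_transportFun]
  · intro hβ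
    have h : T (transportFun f k hU p.symm β) ∈ Submodule.span ℤ (T '' Set.range c) := by
      rw [Submodule.span_image]
      exact Submodule.mem_map_of_mem hβ
    rwa [hT, transportFun_transportFun_symm, ← hrange] at h

/-- **«`ℤ`-span = integral classes» is carried along by transport** (★ p725501 `isIntegralClass_transportFun_iff` along `p⁻¹`, and
`mem_span_int_range_transportFun_iff`). [cite: VoisinHodgeI2002, Rem. 10.17 and §9.2.1] -/
theorem isIntegralClass_iff_mem_span_transportFun (hUh : IsHomotopicallyLocallyTrivialOn f W) {s t : W}
    (p : Path.Homotopic.Quotient s t) {ι : Type} {c : ι → complexBetti (fiberOver f s.1) k}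
    (hc : ∀ α : complexBetti (fiberOver f s.1) k, IsIntegralClass α ↔ α ∈ Submodule.span ℤ (Set.range c))
    (β : complexBetti (fiberOver f t.1) k) :
    IsIntegralClass β ↔ β ∈ Submodule.span ℤ (Set.range fun a ↦ transportFun f k hU p (c a)) := by
  rw [mem_span_int_range_transportFun_iff, ← hc, hUh.isIntegralClass_transportFun_iff f k hU]

/-! ### §3 (N1-exist): the flat integral frame -/

/-- **(N1-exist) A FLAT INTEGRAL FRAME EXTENDING A GIVEN INTEGRAL BASIS.**  Let `f : 𝒳 → S` be homotopically locally trivial over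
`W ⊆ S(ℂ)` (Ehresmann; for smooth projective families ★ `isHomotopicallyLocallyTrivialOn_univ`), `W` path connected, the monodromy of
`Rᵏ f_* ℂ|_W` trivial at `x₀ ∈ W`, and `γ₀ : ι → Hᵏ(X_{x₀}(ℂ); ℚ)` a family whose complexification is `ℂ`-linearly independent with
`ℤ`-span exactly the integral classes.  Then there is `γ : ∀ x : W, ι → Hᵏ(X_x(ℂ); ℚ)` with `γ x₀ = γ₀` and the three clauses of
B-typ02's `IsFlatIntegralFrame f hU γ`: (i) `ℂ`-linear independence at every `x`, (ii) `ℤ`-span = integral classes at every `x`,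
(iii) flatness `p_* (γ x a ⊗ 1) = γ x′ a ⊗ 1` along EVERY path class `p : x ⤳ x′` in `W`.  Construction: `γ x := T_x γ₀` for the
rational transport `T_x` (★ `exists_ratTransport`) along some path `x₀ ⤳ x`. [cite: VoisinHodgeI2002, §9.2.1 and Rem. 10.17]
[cite: LangeBirkenhake1992, Ch. 8 §8.1] -/
theorem exists_flatIntegralFrame_eq (hUh : IsHomotopicallyLocallyTrivialOn f W) (hW : IsPathConnected W) (x₀ : W)
    (htriv : ∀ (p : Path.Homotopic.Quotient x₀ x₀) (c : complexBetti (fiberOver f x₀.1) k), transportFun f k hU p c = c)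
    {ι : Type} (γ₀ : ι → singularCohomology ℚ ℚ (ComplexPoints (fiberOver f x₀.1)) k)
    (hli : LinearIndependent ℂ fun a ↦ ofRatClass _ k (γ₀ a))
    (hint : ∀ c : complexBetti (fiberOver f x₀.1) k,
      IsIntegralClass c ↔ c ∈ Submodule.span ℤ (Set.range fun a ↦ ofRatClass _ k (γ₀ a))) :
    ∃ γ : ∀ x : W, ι → singularCohomology ℚ ℚ (ComplexPoints (fiberOver f x.1)) k,
      γ x₀ = γ₀ ∧
      (∀ x : W, LinearIndependent ℂ fun a ↦ ofRatClass _ k (γ x a)) ∧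
      (∀ (x : W) (c : complexBetti (fiberOver f x.1) k),
        IsIntegralClass c ↔ c ∈ Submodule.span ℤ (Set.range fun a ↦ ofRatClass _ k (γ x a))) ∧
      ∀ (x x' : W) (p : Path.Homotopic.Quotient x x') (a : ι),
        transportFun f k hU p (ofRatClass _ k (γ x a)) = ofRatClass _ k (γ x' a) := by
  haveI : PathConnectedSpace W := isPathConnected_iff_pathConnectedSpace.1 hW
  -- a path class `x₀ ⤳ x` for every `x`, and the rational transport along it
  let q : ∀ x : W, Path.Homotopic.Quotient x₀ x := fun x ↦ ⟦PathConnectedSpace.somePath x₀ x⟧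
  have hrat : ∀ (s t : W) (γ : Path.Homotopic.Quotient s t) (α : complexBetti (fiberOver f s.1) k),
      IsRationalClass α → IsRationalClass (transportFun f k hU γ α) :=
    fun s t γ α hα ↦ hUh.isRationalClass_transportFun f k γ hα
  choose T hT using fun x : W ↦ exists_ratTransport f k hU hrat (q x)
  -- path independence: transport along ANY class `x₀ ⤳ x` is `T x` on rational classes
  have hTp : ∀ (x : W) (p : Path.Homotopic.Quotient x₀ x) (v : singularCohomology ℚ ℚ (ComplexPoints (fiberOver f x₀.1)) k),
      transportFun f k hU p (ofRatClass _ k v) = ofRatClass _ k (T x v) := fun x p v ↦ by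
    rw [hT x v, transportFun_eq_of_trivial_monodromy f k hU htriv p (q x)]
  refine ⟨fun x a ↦ T x (γ₀ a), ?_, fun x ↦ ?_, fun x c ↦ ?_, fun x x' p a ↦ ?_⟩
  · -- `γ x₀ = γ₀`: the transport along a loop at `x₀` is the identity
    funext a
    apply ofRatClass_injective k
    rw [← hTp x₀ (Path.Homotopic.Quotient.refl x₀), transportFun_refl]
  · -- (i) linear independence, transported from `x₀`
    have h := linearIndependent_transportFun f k hU (q x) hli
    simpa only [hTp x (q x)] using h
  · -- (ii) `ℤ`-span = integral classes, transported from `x₀`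
    rw [isIntegralClass_iff_mem_span_transportFun f k hU hUh (q x) hint c]
    simp only [hTp x (q x)]
  · -- (iii) flatness along every path class in `W`
    rw [← hTp x (q x), ← transportFun_trans, hTp x' ((q x).trans p)]

/-- **(N1-exist) over a simply connected base** (e.g. a chart ball, ★ `exists_isOpen_contractibleSpace_of_chartedSpace`): the
monodromy is then trivial everywhere, so every integral basis at `x₀` extends to a flat integral frame over `W`.
[cite: VoisinHodgeI2002, §9.2.1 and Rem. 10.17] -/
theorem exists_flatIntegralFrame_eq_of_simplyConnectedSpace (hUh : IsHomotopicallyLocallyTrivialOn f W) [SimplyConnectedSpace W]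
    (x₀ : W) {ι : Type} (γ₀ : ι → singularCohomology ℚ ℚ (ComplexPoints (fiberOver f x₀.1)) k)
    (hli : LinearIndependent ℂ fun a ↦ ofRatClass _ k (γ₀ a))
    (hint : ∀ c : complexBetti (fiberOver f x₀.1) k,
      IsIntegralClass c ↔ c ∈ Submodule.span ℤ (Set.range fun a ↦ ofRatClass _ k (γ₀ a))) :
    ∃ γ : ∀ x : W, ι → singularCohomology ℚ ℚ (ComplexPoints (fiberOver f x.1)) k,
      γ x₀ = γ₀ ∧
      (∀ x : W, LinearIndependent ℂ fun a ↦ ofRatClass _ k (γ x a)) ∧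
      (∀ (x : W) (c : complexBetti (fiberOver f x.1) k),
        IsIntegralClass c ↔ c ∈ Submodule.span ℤ (Set.range fun a ↦ ofRatClass _ k (γ x a))) ∧
      ∀ (x x' : W) (p : Path.Homotopic.Quotient x x') (a : ι),
        transportFun f k hU p (ofRatClass _ k (γ x a)) = ofRatClass _ k (γ x' a) :=
  exists_flatIntegralFrame_eq f k hU hUh
    (isPathConnected_iff_pathConnectedSpace.2 inferInstance) x₀
    (transportFun_loop_eq_self_of_simplyConnectedSpace f k hU x₀) γ₀ hli hint

end FlatFrame

end Literature.AlgebraicGeometry.HodgeTheory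

end
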